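import Summits.BirchSwinnertonDyer.BirchSwinnertonDyer.Theorems.AdditiveKolyvaginRoadLevelDefs
import Summits.BirchSwinnertonDyer.BirchSwinnertonDyer.Theorems.KolyvaginRoadThreeMethod2Basics
import Literature.NumberTheory.EllipticCurves.KummerSelmerStructure
import Literature.NumberTheory.EllipticCurves.SelmerFiniteProofs
import Literature.NumberTheory.EllipticCurves.SelmerUnramified
import Literature.NumberTheory.EllipticCurves.GaloisActionProofs
import Literature.NumberTheory.GaloisRepresentations.LocalGlobalCohomologyFiniteProofs
import Mathlib.GroupTheory.Index
import HarnessLib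

/-!
# Route `AdditiveKolyvaginRoad`, crux `KolyvaginPrimitiveAdditive` (item stmt-BirchSwinnertonDyer-20132):
# basic facts on the p-GENERIC canonical level-raised Selmer spaces of `Theorems/AdditiveKolyvaginRoadLevelDefs.lean`
# (cell `pub/bsd-wall`, lead prover `bsd-wall-akr-p1`; `--supports stmt-BirchSwinnertonDyer-20132`, helper;
# p-generic port of zhang3-p1's `Theorems/KolyvaginRoadThreeMethod2Basics.lean`, proofs verbatim with `3 ↦ p`)

Two pieces of bookkeeping every prover of the registered stub `stub_rankLoweringAdditive` (A1) of the crux's skeleton v5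
(data in `Theorems/AdditiveKolyvaginRoadLevelDefs.lean`, p508832) needs and should not redo:

* `levelSelmerSubgroupP_empty` ∕ `mem_selQP_empty_iff` — at the BOTTOM level (`n = ∅`, nothing relaxed) the canonical
  space IS the `μ`-eigenspace of complex conjugation on the tree's `p`-Selmer group `selmerGroup (W.baseChange K) p`.
* `finite_levelSelmerSubgroupP` ∕ `finiteDimensional_selRelQP` ∕ `finiteDimensional_selQP` — the canonical space
  relaxed at a FINITE set of admissible primes is finite(-dimensional over `ZMod p`): intersecting with the kernels of
  the localisation maps at the finitely many places above `n ∪ S` — each of finite index, `H¹(K_v, E[p])` being finite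
  (tree `finite_galoisCohomology_one_toLocal`) — lands inside `Sel_p(E/K)`, which is finite (tree
  `finite_selmerGroup_holds`). (For an INFINITE relaxation set the space is infinite-dimensional; nothing is claimed.)
  The two generic lemmas `finite_placesAbove` ∕ `ker_localization_le_selmerLocalKer` are REUSED from zhang3-p1's
  `KolyvaginRoadThreeMethod2Basics` (imported), not restated.

HONEST FRAMING. Elementary consequences of the definitions and of landed tree theorems; no named fact, no `sorry`,
0 defs; nothing about the crux is asserted; nothing is booked. [cite: WZhang2014, §5 (Sel_{𝔭_n}), Lemma 8.4 (3)]
[cite: SilvermanAEC2009, Thm X.4.2(b)]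
-/

-- single-conjunct summit: `Summit.BirchSwinnertonDyer.BirchSwinnertonDyer.…` repeats the name by design
set_option linter.dupNamespace false

noncomputable section

open scoped Classical

namespace Summit.BirchSwinnertonDyer.BirchSwinnertonDyer.Theorems.AdditiveKoly

open WeierstrassCurve NumberField IsDedekindDomain
  Literature.NumberTheory.EllipticCurves Literature.NumberTheory.GaloisRepresentations Module

variable (W : WeierstrassCurve ℚ) (K : Type) [Field K] [NumberField K] (p : ℕ) (c : K ≃ₐ[ℚ] K)

/-! ## The bottom level: `Sel_∅^μ` is the `μ`-eigenspace of `Sel_p(E/K)` -/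

/-- **At level `∅`, relaxed nowhere, the canonical space is the `μ`-eigenspace of the tree's `p`-Selmer group**:
`levelSelmerSubgroupP W K p c ∅ ∅ μ = ker (τ − sgn μ) ⊓ Sel_p(E/K)` (the toric conditions are indexed by the empty
set, the Kummer conditions by all places). [cite: WZhang2014, §5 (Sel_{𝔭_n} at n = 1)] -/
theorem levelSelmerSubgroupP_empty (μ : Bool) :
    levelSelmerSubgroupP W K p c ∅ ∅ μ =
      (conjAct W c ((p ^ 1 : ℕ) : ℤ) - sgnP μ • AddMonoidHom.id (Vp W K p)).ker ⊓
        selmerGroup (W.baseChange K) ((p ^ 1 : ℕ) : ℤ) := by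
  ext x
  simp only [levelSelmerSubgroupP, WeierstrassCurve.mem_selmerGroup_iff, AddSubgroup.mem_inf,
    AddSubgroup.mem_iInf, Finset.coe_empty, Set.empty_union, Set.mem_empty_iff_false, imp_true_iff,
    Finset.notMem_empty, false_and, IsEmpty.forall_iff, and_true, true_imp_iff]
  tauto

/-- Membership form of `levelSelmerSubgroupP_empty`: `x ∈ SelQP W K p c ∅ μ` iff `x` is a `p`-Selmer class of `E/K`
in the `sgn μ`-eigenspace of complex conjugation. [cite: WZhang2014, §5 (Sel_{𝔭_n} at n = 1)] -/
theorem mem_selQP_empty_iff [W.IsGloballyMinimal] [Module (ZMod p) (Vp W K p)] (μ : Bool) (x : Vp W K p) :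
    x ∈ SelQP W K p c ∅ μ ↔
      conjAct W c ((p ^ 1 : ℕ) : ℤ) x = sgnP μ • x ∧ x ∈ selmerGroup (W.baseChange K) ((p ^ 1 : ℕ) : ℤ) := by
  change x ∈ (AddSubgroup.toZModSubmodule p (levelSelmerSubgroupP W K p c (Finset.image Subtype.val ∅) ∅ μ) :
    Set (Vp W K p)) ↔ _
  rw [AddSubgroup.coe_toZModSubmodule, Finset.image_empty, levelSelmerSubgroupP_empty]
  simp only [AddSubgroup.coe_inf, Set.mem_inter_iff, SetLike.mem_coe, AddMonoidHom.mem_ker, AddMonoidHom.sub_apply,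
    sub_eq_zero]
  exact Iff.rfl

/-! ## Finiteness of the canonical spaces relaxed at finitely many primes -/

/-- **The canonical level-raised Selmer space relaxed at a FINITE set is finite** (general prime `p`). For a finite
set `n` and a finite set `S` of NON-ZERO natural numbers, `levelSelmerSubgroupP W K p c n S μ` is a finite group: cut by
the (finite-index) kernels of the localisations at the finitely many places above `n ∪ S` it lies in `Sel_p(E/K)`
(finite, tree `finite_selmerGroup_holds`). [cite: SilvermanAEC2009, Thm X.4.2(b)] -/
theorem finite_levelSelmerSubgroupP [W.IsElliptic] [Fact p.Prime] (n : Finset ℕ) (S : Set ℕ) (hS : S.Finite)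
    (h0 : (0 : ℕ) ∉ (n : Set ℕ) ∪ S) (μ : Bool) : Finite (levelSelmerSubgroupP W K p c n S μ) := by
  set Np : ℤ := ((p ^ 1 : ℕ) : ℤ) with hNp
  have hNpne : Np ≠ 0 := by
    rw [hNp, pow_one]
    exact_mod_cast (Fact.out : p.Prime).ne_zero
  set ρ := (W.baseChange K).torsionGaloisModule Np with hρ
  -- the finitely many places above `n ∪ S`
  set P : Set (HeightOneSpectrum (𝓞 K)) := {v | ∃ q ∈ (n : Set ℕ) ∪ S, (q : 𝓞 K) ∈ v.asIdeal} with hP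
  have hPfin : P.Finite := Summit.BirchSwinnertonDyer.Rank1Residual.X11b.Three.Koly.Method2.finite_placesAbove K ((n : Set ℕ) ∪ S) (n.finite_toSet.union hS) h0
  haveI : Finite P := hPfin.to_subtype
  -- `E[p]` is finite, hence so is every `H¹(K_v, E[p])`
  haveI : Finite (geomTorsion (W.baseChange K) Np) :=
    finite_torsionPoints_holds (W.baseChange K) (AlgebraicClosure K) hNpne
  -- the localisation kernels at the places of `P`, each of finite index
  let L : P → AddSubgroup (Vp W K p) := fun v ↦ (galoisCohomology.localization ρ (Sum.inr v.1) 1).ker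
  have hLfi : ∀ v, (L v).FiniteIndex := fun v ↦ by
    haveI : Finite (galoisCohomology (ρ.toLocal (Sum.inr v.1)) 1) := finite_galoisCohomology_one_toLocal ρ v.1
    haveI : Finite (galoisCohomology.localization ρ (Sum.inr v.1) 1).range := inferInstance
    exact AddSubgroup.finiteIndex_ker _
  set Nk : AddSubgroup (Vp W K p) := ⨅ v, L v with hNk
  haveI hNkfi : Nk.FiniteIndex := AddSubgroup.finiteIndex_iInf hLfi
  -- inside the kernels, the relaxed space lies in the Selmer group
  set Lsel := levelSelmerSubgroupP W K p c n S μ with hLsel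
  have hle : Lsel ⊓ Nk ≤ selmerGroup (W.baseChange K) Np := by
    intro x hx
    obtain ⟨hxL, hxN⟩ := AddSubgroup.mem_inf.mp hx
    rw [mem_selmerGroup_iff]
    have hxL' := hxL
    simp only [hLsel, levelSelmerSubgroupP, AddSubgroup.mem_inf, AddSubgroup.mem_iInf] at hxL'
    obtain ⟨-, hinf, hfin, -⟩ := hxL'
    refine ⟨fun v ↦ ?_, fun w ↦ hinf w⟩
    by_cases hv : v ∈ P
    · -- at a place above `n ∪ S`: localisation zero ⇒ Kummer condition
      have hxv : x ∈ L ⟨v, hv⟩ := (AddSubgroup.mem_iInf.mp hxN) ⟨v, hv⟩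
      exact Summit.BirchSwinnertonDyer.Rank1Residual.X11b.Three.Koly.Method2.ker_localization_le_selmerLocalKer (W.baseChange K) Np v hxv
    · -- away from `n ∪ S`: the Kummer condition is imposed
      refine hfin v fun q hq hqv ↦ hv ⟨q, hq, hqv⟩
  -- the Selmer group is finite, hence so is `Lsel ⊓ Nk`
  haveI hSelfin : Finite (selmerGroup (W.baseChange K) Np) :=
    (W.baseChange K).finite_selmerGroup_holds hNpne
  have hinf_fin : Finite (Lsel ⊓ Nk : AddSubgroup (Vp W K p)) :=
    Finite.of_injective (fun x ↦ (⟨x.1, hle x.2⟩ : selmerGroup (W.baseChange K) Np))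
      (fun x y h ↦ Subtype.ext (by simpa using congrArg Subtype.val h))
  -- a group with a finite subgroup of finite index is finite
  rw [AddSubgroup.finite_iff_finite_and_finiteIndex (Nk.addSubgroupOf Lsel)]
  refine ⟨?_, inferInstance⟩
  exact Finite.of_injective
    (fun x : Nk.addSubgroupOf Lsel ↦ (⟨x.1.1, AddSubgroup.mem_inf.mpr ⟨x.1.2, x.2⟩⟩ : (Lsel ⊓ Nk : AddSubgroup _)))
    (fun x y h ↦ Subtype.ext (Subtype.ext (by simpa using congrArg (fun z ↦ z.1) h)))

variable [W.IsGloballyMinimal]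

omit [NumberField K] in
/-- Admissible primes are primes, in particular non-zero. [cite: BertoliniDarmon2005, p. 18] -/
theorem AdmQ.ne_zero (q : AdmQ W K p) : (q : ℕ) ≠ 0 := q.2.1.ne_zero

/-- **`SelRel_n,S^μ` is finite-dimensional for a FINITE set `S` of admissible primes** (in particular the un-relaxed
`Sel_n^μ`, `finiteDimensional_selQP`). Not true for infinite `S`. [cite: WZhang2014, Lemma 8.4 (3) (relaxed Selmer
group)] -/
theorem finiteDimensional_selRelQP [W.IsElliptic] [Fact p.Prime] [Module (ZMod p) (Vp W K p)]
    (n : Finset (AdmQ W K p)) {S : Set (AdmQ W K p)} (hS : S.Finite)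
    (μ : Bool) : FiniteDimensional (ZMod p) (SelRelQP W K p c n S μ) := by
  have hfin : Finite (levelSelmerSubgroupP W K p c (n.image Subtype.val) (Subtype.val '' S) μ) := by
    refine finite_levelSelmerSubgroupP W K p c _ _ (hS.image _) ?_ μ
    rintro (h | h)
    · rw [Finset.mem_coe, Finset.mem_image] at h
      obtain ⟨q, -, hq⟩ := h
      exact AdmQ.ne_zero W K p q hq
    · obtain ⟨q, -, hq⟩ := h
      exact AdmQ.ne_zero W K p q hq
  have hfin' : Finite (SelRelQP W K p c n S μ) := by
    change Finite (AddSubgroup.toZModSubmodule p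
      (levelSelmerSubgroupP W K p c (n.image Subtype.val) (Subtype.val '' S) μ))
    exact Finite.of_equiv _ (Equiv.setCongr (AddSubgroup.coe_toZModSubmodule p _).symm)
  exact Module.Finite.of_finite

/-- **`Sel_n^μ` is finite-dimensional.** [cite: WZhang2014, §5 (Sel_{𝔭_n})] -/
theorem finiteDimensional_selQP [W.IsElliptic] [Fact p.Prime] [Module (ZMod p) (Vp W K p)]
    (n : Finset (AdmQ W K p)) (μ : Bool) : FiniteDimensional (ZMod p) (SelQP W K p c n μ) := by
  rw [selQP_eq_selRelQP_empty]
  exact finiteDimensional_selRelQP W K p c n Set.finite_empty μ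

end Summit.BirchSwinnertonDyer.BirchSwinnertonDyer.Theorems.AdditiveKoly

end
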